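import Summits.Ventures.LatticeQCDFlow.Scoring.OnePlaquetteHaarMGF
import Literature.Analysis.FunctionSpaces.BesselIDerivative
import HarnessLib

/-!
# The `U(N)` one-plaquette PLAQUETTE in Bessel form for every `N`: `⟨(1/N) Re tr U_p⟩_β = Σ_l (det M⁻_l + det M⁺_l) / (2N det M)`

HONEST FRAMING: exact (Metropolis-corrected) sampling algorithms for lattice gauge theory;
figures of merit are autocorrelation/cost numbers at stated couplings and volumes; no
continuum-physics claim.

Venture `LatticeQCDFlow` (cell pub-lqcd), sub-topic `Scoring`; FANOUT row 5 (`s0-sun-a`), GEN-17.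
NEW WORK of the cell (placement rule).  GEN-16's `OnePlaquetteSU3PlaquetteBessel` gave the `SU(3)` plaquette as a
ratio of Bessel–Toeplitz series with one column shifted by `±1`; here the `U(N)` analogue FOR EVERY `N`, on the
Haar measure, as the explicit oracle formula one evaluates:

* §1 **Jacobi's formula in Leibniz form**: if every entry `x ↦ M(x)_{ij}` has derivative `M'_{ij}` at `x`, then
  `d/dx det M(x) = Σ_l det(M with column l replaced by the column l of M')`;
* §2 with `M(x) = [I_{|i−j|}(x)]` and `I_{|m|}' = (I_{|m−1|} + I_{|m+1|})/2` (the tree's `hasDerivAt_besselI_natAbs`,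
  DLMF 10.29.1): `d/dx det[I_{|i−j|}(x)] = ½ Σ_l (det M⁻_l(x) + det M⁺_l(x))`, `M^±_l` = `M` with column `l`
  replaced by `(I_{|i−l∓1|}(x))_i`;
* §3 with `OnePlaquetteHaarMGF` (`plaquette = (1/N)(log det)'`):
  **`⟨(1/N) Re tr U_p⟩_β^{U(N)} = Σ_l (det M⁻_l(β) + det M⁺_l(β)) / (2N · det[I_{|i−j|}(β)])`** for every `N ≥ 1`;
  `N = 1`: `I₁(β)/I₀(β)` (GEN-7's `U(1)` value); `N = 2`: `I₁(I₀ − I₂)/(2(I₀² − I₁²))` at `β`.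

No `def`, nothing cited as a fact, 0 sorry.
-/

noncomputable section

open Real MeasureTheory Finset Complex Set
open scoped ENNReal
open ProbabilityTheory
open Literature.MathematicalPhysics.QuantumFieldTheory
open Literature.MathematicalPhysics.QuantumLattice
open Literature.Analysis.FunctionSpaces

namespace Summit.Ventures.LatticeQCDFlow.Scoring

/-! ### 1. The derivative of a determinant, column by column -/

/-- **`d/dx det M(x) = Σ_l det(M(x) with column l replaced by its derivative)`** (Jacobi's formula in Leibniz
form): entrywise derivatives `M'_{ij}` at `x` give the derivative of the determinant. -/
theorem hasDerivAt_matrix_det {ι : Type*} [Fintype ι] [DecidableEq ι] {M : ℝ → Matrix ι ι ℝ} {M' : Matrix ι ι ℝ}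
    {x : ℝ} (hM : ∀ i j, HasDerivAt (fun y => M y i j) (M' i j) x) :
    HasDerivAt (fun y => (M y).det) (∑ l, ((M x).updateCol l fun i => M' i l).det) x := by
  have hdet : (fun y => (M y).det) = fun y => ∑ σ : Equiv.Perm ι, (Equiv.Perm.sign σ : ℤ) * ∏ i, M y (σ i) i := by
    funext y
    rw [Matrix.det_apply']
  rw [hdet]
  -- derivative of each Leibniz term
  have hterm : ∀ σ : Equiv.Perm ι, HasDerivAt (fun y => ((Equiv.Perm.sign σ : ℤ) : ℝ) * ∏ i, M y (σ i) i)
      (((Equiv.Perm.sign σ : ℤ) : ℝ) * ∑ l, (∏ j ∈ Finset.univ.erase l, M x (σ j) j) * M' (σ l) l) x := by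
    intro σ
    have h := HasDerivAt.fun_finsetProd (u := Finset.univ) (f := fun i y => M y (σ i) i) (f' := fun i => M' (σ i) i)
      (x := x) (fun i _ => hM (σ i) i)
    simp only [smul_eq_mul] at h
    exact h.const_mul _
  have hsum := HasDerivAt.fun_sum (u := Finset.univ) (fun σ (_ : σ ∈ Finset.univ) => hterm σ)
  refine hsum.congr_deriv ?_
  -- regroup: `Σ_σ sgn σ Σ_l (Π_{j≠l} M_{σj,j}) M'_{σl,l} = Σ_l det(updateCol l)`
  simp_rw [Finset.mul_sum]
  rw [Finset.sum_comm]
  refine Finset.sum_congr rfl fun l _ => ?_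
  rw [Matrix.det_apply']
  refine Finset.sum_congr rfl fun σ _ => ?_
  rw [← Finset.mul_prod_erase Finset.univ _ (Finset.mem_univ l), Matrix.updateCol_self]
  congr 1
  rw [mul_comm]
  congr 1
  refine Finset.prod_congr rfl fun j hj => ?_
  rw [Matrix.updateCol_ne (Finset.ne_of_mem_erase hj)]

/-! ### 2. `d/dx det[I_{|i−j|}(x)] = ½ Σ_l (det M⁻_l + det M⁺_l)` -/

/-- **THE DERIVATIVE OF THE BESSEL–TOEPLITZ DETERMINANT**:
`d/dx det[I_{|i−j|}(x)] = ½ Σ_l (det M⁻_l(x) + det M⁺_l(x))`, where `M^∓_l` is `[I_{|i−j|}(x)]` with column `l`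
replaced by `(I_{|i−l−1|}(x))_i`, resp. `(I_{|i−l+1|}(x))_i`. -/
theorem hasDerivAt_det_besselI_toeplitz_columns (N : ℕ) (x : ℝ) :
    HasDerivAt (fun y : ℝ => (Matrix.of fun i j : Fin N => besselI ((i : ℤ) - (j : ℤ)).natAbs y).det)
      ((1 / 2 : ℝ) * ∑ l : Fin N,
        (((Matrix.of fun i j : Fin N => besselI ((i : ℤ) - (j : ℤ)).natAbs x).updateCol l
            fun i => besselI ((i : ℤ) - (l : ℤ) - 1).natAbs x).det
          + ((Matrix.of fun i j : Fin N => besselI ((i : ℤ) - (j : ℤ)).natAbs x).updateCol l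
            fun i => besselI ((i : ℤ) - (l : ℤ) + 1).natAbs x).det)) x := by
  have h := hasDerivAt_matrix_det (ι := Fin N)
    (M := fun y => Matrix.of fun i j : Fin N => besselI ((i : ℤ) - (j : ℤ)).natAbs y)
    (M' := Matrix.of fun i j : Fin N =>
      (besselI ((i : ℤ) - (j : ℤ) - 1).natAbs x + besselI ((i : ℤ) - (j : ℤ) + 1).natAbs x) / 2)
    (x := x) (fun i j => by simpa [Matrix.of_apply] using hasDerivAt_besselI_natAbs ((i : ℤ) - (j : ℤ)) x)
  refine h.congr_deriv ?_
  rw [Finset.mul_sum]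
  refine Finset.sum_congr rfl fun l _ => ?_
  simp only [Matrix.of_apply]
  rw [show (fun i : Fin N => (besselI ((i : ℤ) - (l : ℤ) - 1).natAbs x + besselI ((i : ℤ) - (l : ℤ) + 1).natAbs x) / 2)
      = (1 / 2 : ℝ) • ((fun i : Fin N => besselI ((i : ℤ) - (l : ℤ) - 1).natAbs x)
          + fun i : Fin N => besselI ((i : ℤ) - (l : ℤ) + 1).natAbs x) from by
        funext i; simp only [Pi.smul_apply, Pi.add_apply, smul_eq_mul]; ring,
    Matrix.det_updateCol_smul, Matrix.det_updateCol_add]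

/-! ### 3. The `U(N)` plaquette in Bessel form -/

/-- **THE `U(N)` ONE-PLAQUETTE PLAQUETTE IN BESSEL FORM, EVERY `N ≥ 1`**:
`∫ (1/N) Re tr U e^{−β(N − Re tr U)} dU / ∫ e^{−β(N − Re tr U)} dU = Σ_l (det M⁻_l(β) + det M⁺_l(β)) / (2N det[I_{|i−j|}(β)])`. -/
theorem unitary_plaquette_eq_bessel (N : ℕ) [NeZero N] (β : ℝ) :
    (∫ u, ((u : Matrix.unitaryGroup (Fin N) ℂ) : Matrix (Fin N) (Fin N) ℂ).trace.re / N *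
          Real.exp (-(β * ((N : ℝ) - ((u : Matrix.unitaryGroup (Fin N) ℂ) : Matrix (Fin N) (Fin N) ℂ).trace.re)))
        ∂(haarProbability (Matrix.unitaryGroup (Fin N) ℂ)))
      / (∫ u, Real.exp (-(β * ((N : ℝ) - ((u : Matrix.unitaryGroup (Fin N) ℂ) : Matrix (Fin N) (Fin N) ℂ).trace.re)))
        ∂(haarProbability (Matrix.unitaryGroup (Fin N) ℂ)))
      = (∑ l : Fin N,
          (((Matrix.of fun i j : Fin N => besselI ((i : ℤ) - (j : ℤ)).natAbs β).updateCol l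
              fun i => besselI ((i : ℤ) - (l : ℤ) - 1).natAbs β).det
            + ((Matrix.of fun i j : Fin N => besselI ((i : ℤ) - (j : ℤ)).natAbs β).updateCol l
              fun i => besselI ((i : ℤ) - (l : ℤ) + 1).natAbs β).det))
        / (2 * N * (Matrix.of fun i j : Fin N => besselI ((i : ℤ) - (j : ℤ)).natAbs β).det) := by
  rw [unitary_plaquette_eq_deriv_log_det]
  have hpos := det_besselI_toeplitz_fin_pos N β
  have hlog : HasDerivAt (fun x : ℝ => Real.log (Matrix.of fun i j : Fin N => besselI ((i : ℤ) - (j : ℤ)).natAbs x).det)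
      (((1 / 2 : ℝ) * ∑ l : Fin N,
        (((Matrix.of fun i j : Fin N => besselI ((i : ℤ) - (j : ℤ)).natAbs β).updateCol l
            fun i => besselI ((i : ℤ) - (l : ℤ) - 1).natAbs β).det
          + ((Matrix.of fun i j : Fin N => besselI ((i : ℤ) - (j : ℤ)).natAbs β).updateCol l
            fun i => besselI ((i : ℤ) - (l : ℤ) + 1).natAbs β).det))
        / (Matrix.of fun i j : Fin N => besselI ((i : ℤ) - (j : ℤ)).natAbs β).det) β :=
    (hasDerivAt_det_besselI_toeplitz_columns N β).log hpos.ne'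
  rw [hlog.deriv]
  have hN : (N : ℝ) ≠ 0 := Nat.cast_ne_zero.2 (NeZero.ne N)
  field_simp

/-- Sanity check `N = 1`: the `U(1)` plaquette is `I₁(β)/I₀(β)` (GEN-7's `OnePlaquetteBessel`). -/
theorem unitary_plaquette_one_eq (β : ℝ) :
    (∫ u, ((u : Matrix.unitaryGroup (Fin 1) ℂ) : Matrix (Fin 1) (Fin 1) ℂ).trace.re / (1 : ℕ) *
          Real.exp (-(β * (((1 : ℕ) : ℝ) - ((u : Matrix.unitaryGroup (Fin 1) ℂ) : Matrix (Fin 1) (Fin 1) ℂ).trace.re)))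
        ∂(haarProbability (Matrix.unitaryGroup (Fin 1) ℂ)))
      / (∫ u, Real.exp (-(β * (((1 : ℕ) : ℝ) - ((u : Matrix.unitaryGroup (Fin 1) ℂ) : Matrix (Fin 1) (Fin 1) ℂ).trace.re)))
        ∂(haarProbability (Matrix.unitaryGroup (Fin 1) ℂ)))
      = besselI 1 β / besselI 0 β := by
  rw [unitary_plaquette_eq_bessel 1 β]
  simp only [Fin.sum_univ_one, Matrix.det_unique, Matrix.updateCol_apply, Matrix.of_apply, Fin.default_eq_zero,
    Fin.val_zero, Nat.cast_zero, Nat.cast_one, sub_self, zero_sub, Int.natAbs_zero, if_true]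
  have h0 : besselI 0 β ≠ 0 := (besselI_zero_pos β).ne'
  field_simp
  ring

/-- `N = 2`: **`⟨½ Re tr U_p⟩_β^{U(2)} = I₁(β)(I₀(β) − I₂(β)) / (2 (I₀(β)² − I₁(β)²))`** (the four column
replacements give `0`, `I₁I₀ − I₁I₂`, `I₀I₁ − I₂I₁`, `0`; the denominator is `det[[I₀, I₁], [I₁, I₀]]`). -/
theorem unitary_plaquette_two_eq (β : ℝ) :
    (∫ u, ((u : Matrix.unitaryGroup (Fin 2) ℂ) : Matrix (Fin 2) (Fin 2) ℂ).trace.re / (2 : ℕ) *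
          Real.exp (-(β * (((2 : ℕ) : ℝ) - ((u : Matrix.unitaryGroup (Fin 2) ℂ) : Matrix (Fin 2) (Fin 2) ℂ).trace.re)))
        ∂(haarProbability (Matrix.unitaryGroup (Fin 2) ℂ)))
      / (∫ u, Real.exp (-(β * (((2 : ℕ) : ℝ) - ((u : Matrix.unitaryGroup (Fin 2) ℂ) : Matrix (Fin 2) (Fin 2) ℂ).trace.re)))
        ∂(haarProbability (Matrix.unitaryGroup (Fin 2) ℂ)))
      = besselI 1 β * (besselI 0 β - besselI 2 β) / (2 * (besselI 0 β ^ 2 - besselI 1 β ^ 2)) := by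
  rw [unitary_plaquette_eq_bessel 2 β]
  have hpos := det_besselI_toeplitz_fin_pos 2 β
  simp only [Fin.sum_univ_two, Matrix.det_fin_two, Matrix.updateCol_apply, Matrix.of_apply, Fin.val_zero,
    Fin.val_one, Nat.cast_zero, Nat.cast_one, Nat.cast_ofNat, sub_self, zero_sub, sub_zero, Int.natAbs_zero,
    Int.natAbs_one, if_true, Fin.zero_eq_one_iff, OfNat.ofNat_ne_one, one_ne_zero, if_false] at hpos ⊢
  norm_num at hpos ⊢
  have h0 : besselI 0 β ^ 2 - besselI 1 β ^ 2 ≠ 0 := by nlinarith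
  field_simp
  ring

end Summit.Ventures.LatticeQCDFlow.Scoring
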